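import Summits.NavierStokesRegularity.NavierStokesRegularity.Theses.AdaptedFrequency
import Summits.NavierStokesRegularity.NavierStokesRegularity.Theorems.AdaptedFrequencyTangentFlowTransferBlowupData
import Summits.NavierStokesRegularity.NavierStokesRegularity.Theorems.AdaptedFrequencyTangentFlowTransferWindowExtraction
import Summits.NavierStokesRegularity.NavierStokesRegularity.Theorems.AdaptedFrequencyTangentFlowTransferFrequencyTransfer
import Summits.NavierStokesRegularity.NavierStokesRegularity.Theorems.AdaptedFrequencyTangentFlowTransferDilation
import Summits.NavierStokesRegularity.NavierStokesRegularity.Theorems.AdaptedFrequencyTangentFlowTransferAncientPressure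
import Summits.NavierStokesRegularity.NavierStokesRegularity.Theorems.AdaptedFrequencyTangentFlowTransferPositivity
import Summits.NavierStokesRegularity.NavierStokesRegularity.Theorems.AdaptedFrequencyTangentFlowTransferKernelStability
import Summits.NavierStokesRegularity.NavierStokesRegularity.Theorems.AdaptedFrequencyTangentFlowTransferPersistence
import HarnessLib

/-!
# `TangentFlowTransfer` from kernel stability and non-degeneracy of the tangent flow
# (route `AdaptedFrequency`, item `TangentFlowTransfer`, stmt-NavierStokesRegularity-10494)

Helper file (all results proved; `--supports` the item, which it reduces to two explicit
hypotheses). `tangentFlowTransfer_of_hyp hB hC : TangentFlowTransfer` assembles the Type-I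
blow-up argument of the item from the landed helper files:

1. viscosity normalisation `ν ↦ 1` and the zoom `λ_k = 1/(k+1) → 0` about the backward-singular
   pole, with every clause covariant and the Gaussian constants fixed
   (`exists_zoom_blowupData`: classical, Type I, Oseen-mild on windows `[A_k, 0)`, `A_k → −∞`,
   adapted kernels, `Λ_k(τ) → Λ₀`);
2. `C²_loc` compactness of the zoomed velocities (`exists_tendsto_of_typeI_oseenMild_windows`):
   a subsequence converges slice-wise locally uniformly with two derivatives to a Type-I ancient
   mild field `W`, which is classical for one pressure on `(−∞, 0)`
   (`exists_isClassicalNSSolutionOn_Iio_of_isTypeIAncientMild`);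
3. **kernel stability** (hypothesis (B) of `tangentFlowTransfer_of_hyp`, PROVED as
   `kernelStability` in `AdaptedFrequencyTangentFlowTransferKernelStability`): along such a sequence
   the adapted kernels have a further subsequence converging pointwise to a jointly `C²` solution
   `K` of `∂ₜK + W·∇K + ΔK = 0` on `(−∞, 0)` (pointwise extraction by the interior drift–heat
   Lipschitz estimate, very weak limit, Hörmander hypoellipticity, identification); the other
   kernel clauses and the Gaussian bounds of `K` are then automatic
   (`isAdaptedBackwardKernel_of_limit`);
4. **hypothesis (C), non-degeneracy**: the vorticity of any such blow-up limit `W` at a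
   backward-singular point vanishes identically on no time slice (persistence of singularities +
   uniqueness of bounded mild solutions; not in the tree); with `K > 0` this gives `H̄ > 0`
   (`adaptedEnstrophy_pos_of_exists_curl_ne_zero`);
5. transfer of the frequency, `Λ̄ ≡ Λ₀` (`adaptedFrequency_limit_eq`: uniform `C³` window bounds,
   `H_k′ = ∫ (L‖ω_k‖²) g_k`, dominated convergence, `limit_frequency_eq_forall`);
6. dilation back to viscosity `ν` (`AdaptedFrequencyTangentFlowTransferDilation`), which keeps
   positivity of `H̄` and constancy of `Λ̄`.

The hypotheses are spelled out as binders (no new definitions). With (B) proved, the item is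
reduced to the single hypothesis (C) (`tangentFlowTransfer_of_nondegeneracy`), and further to
persistence of the singularity in the blow-up limit (`tangentFlowTransfer_of_persistence`, via
`AdaptedFrequencyTangentFlowTransferPersistence`).
-/

noncomputable section

open MeasureTheory Set Function Filter TopologicalSpace Metric
open scoped Topology NNReal ENNReal InnerProductSpace Laplacian

namespace Summit.NavierStokesRegularity.NavierStokesRegularity.Theorems

open Literature.Analysis Literature.Analysis.FluidPDE

local notation "ℝ³" => EuclideanSpace ℝ (Fin 3)

/-- Subsequences of locally uniformly convergent sequences converge locally uniformly. [folklore] -/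
theorem tendstoLocallyUniformly_comp_of_tendsto {X Y : Type*} [TopologicalSpace X] [UniformSpace Y]
    {F : ℕ → X → Y} {f : X → Y} (h : TendstoLocallyUniformly F f atTop) {ψ : ℕ → ℕ}
    (hψ : Tendsto ψ atTop atTop) : TendstoLocallyUniformly (fun j => F (ψ j)) f atTop := by
  intro u hu x
  obtain ⟨t, ht, hev⟩ := h u hu x
  exact ⟨t, ht, hψ.eventually hev⟩

/-- The scales of the blow-up sequence, `λ_k = 1/(k+1)`. [folklore] -/
theorem one_div_nat_succ_pos (k : ℕ) : (0:ℝ) < 1 / ((k:ℝ) + 1) :=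
  one_div_pos.2 (Nat.cast_add_one_pos k)

/-- **The pointwise limit of uniformly Gaussian-comparable unit-mass kernels is an adapted
kernel** once it is `C²` and solves the limit adjoint equation: the two-sided Gaussian bounds
pass to the limit, give positivity, unit mass follows by dominated convergence, and
concentration at the pole from the Gaussian upper bound
(`tendsto_integral_mul_of_gaussian_upper_fin_three`). This is the part of kernel stability that
needs no parabolic regularity. [folklore] -/
theorem isAdaptedBackwardKernel_of_limit {W : ℝ → ℝ³ → ℝ³} {K : ℝ → ℝ³ → ℝ}
    {g : ℕ → ℝ → ℝ³ → ℝ} {A : ℕ → ℝ} (hA : Tendsto A atTop atBot)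
    (hg1 : ∀ k, ∀ t ∈ Ico (A k) 0, ∫ x, g k t x = 1)
    (hgc : ∀ k, ∀ t ∈ Ico (A k) 0, Continuous (g k t)) {c₁ c₂ C₁ C₂ : ℝ} (hc₁ : 0 < c₁)
    (hC₂ : 0 < C₂)
    (hgb : ∀ k, ∀ t ∈ Ico (A k) 0, ∀ x,
      c₁ * ((0:ℝ) - t) ^ (-(3:ℝ) / 2) * Real.exp (-(‖x - (0 : ℝ³)‖ ^ 2) / (c₂ * ((0:ℝ) - t))) ≤
          g k t x ∧
        g k t x ≤ C₁ * ((0:ℝ) - t) ^ (-(3:ℝ) / 2) *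
          Real.exp (-(‖x - (0 : ℝ³)‖ ^ 2) / (C₂ * ((0:ℝ) - t))))
    (hKc : ContDiffOn ℝ 2 (uncurry K) (Iio 0 ×ˢ univ))
    (hKeq : ∀ t ∈ Iio (0:ℝ), ∀ x,
      timeDerivWithin (Iio 0) K t x + fderiv ℝ (K t) x (W t x) + 1 * (Δ (K t)) x = 0)
    (hgK : ∀ t < 0, ∀ x, Tendsto (fun k => g k t x) atTop (𝓝 (K t x))) :
    IsAdaptedBackwardKernel 1 W (Iio 0) 0 0 K ∧
      ∀ t ∈ Iio (0:ℝ), ∀ x,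
        c₁ * ((0:ℝ) - t) ^ (-(3:ℝ) / 2) * Real.exp (-(‖x - (0 : ℝ³)‖ ^ 2) / (c₂ * ((0:ℝ) - t))) ≤
            K t x ∧
          K t x ≤ C₁ * ((0:ℝ) - t) ^ (-(3:ℝ) / 2) *
            Real.exp (-(‖x - (0 : ℝ³)‖ ^ 2) / (C₂ * ((0:ℝ) - t))) := by
  -- beyond `k₀(t)` the window `[A_k, 0)` contains `t`
  have hwin : ∀ t < 0, ∃ k₀ : ℕ, ∀ j, t ∈ Ico (A (j + k₀)) 0 := by
    intro t ht
    obtain ⟨k₀, hk₀⟩ := eventually_atTop.1 (hA.eventually (eventually_le_atBot t))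
    exact ⟨k₀, fun j => ⟨hk₀ _ (Nat.le_add_left _ _), ht⟩⟩
  -- the Gaussian bounds pass to the limit
  have hKb : ∀ t ∈ Iio (0:ℝ), ∀ x,
      c₁ * ((0:ℝ) - t) ^ (-(3:ℝ) / 2) * Real.exp (-(‖x - (0 : ℝ³)‖ ^ 2) / (c₂ * ((0:ℝ) - t))) ≤
          K t x ∧
        K t x ≤ C₁ * ((0:ℝ) - t) ^ (-(3:ℝ) / 2) *
          Real.exp (-(‖x - (0 : ℝ³)‖ ^ 2) / (C₂ * ((0:ℝ) - t))) := by
    intro t ht x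
    obtain ⟨k₀, hk₀⟩ := hwin t ht
    have hlim := (hgK t ht x).comp (tendsto_add_atTop_nat k₀)
    exact ⟨ge_of_tendsto hlim (Eventually.of_forall fun j => (hgb _ t (hk₀ j) x).1),
      le_of_tendsto hlim (Eventually.of_forall fun j => (hgb _ t (hk₀ j) x).2)⟩
  have hK0 : ∀ t ∈ Iio (0:ℝ), ∀ x, 0 < K t x := by
    intro t ht x
    refine lt_of_lt_of_le ?_ (hKb t ht x).1
    have h1 : 0 < (0:ℝ) - t := by simpa using ht
    exact mul_pos (mul_pos hc₁ (Real.rpow_pos_of_pos h1 _)) (Real.exp_pos _)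
  -- unit mass by dominated convergence
  have h3 : ((Module.finrank ℝ ℝ³ : ℕ) : ℝ) = 3 := by rw [finrank_euclideanSpace_fin]; norm_num
  have hK1 : ∀ t ∈ Iio (0:ℝ), ∫ x, K t x = 1 := by
    intro t ht
    obtain ⟨k₀, hk₀⟩ := hwin t ht
    have ht' : t < 0 := ht
    have hdomi : Integrable (fun x : ℝ³ => C₁ * ((0:ℝ) - t) ^ (-(3:ℝ) / 2) *
        Real.exp (-(‖x - (0 : ℝ³)‖ ^ 2) / (C₂ * ((0:ℝ) - t)))) (volume : Measure ℝ³) := by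
      have h := (integrable_backwardHeatKernel (E := ℝ³) (ν := C₂ / 4) (T := 0) (t := t)
        (by positivity) ht' (0 : ℝ³)).const_mul (C₁ * (Real.pi * C₂) ^ ((3 : ℝ) / 2))
      refine h.congr (Eventually.of_forall fun x => ?_)
      have e := gaussian_eq_const_mul_backwardHeatKernel (E := ℝ³) (T := 0) ht' (0 : ℝ³) x C₁ hC₂
      rw [h3] at e
      simp only
      rw [e]
    have hlim : Tendsto (fun j => ∫ x, g (j + k₀) t x) atTop (𝓝 (∫ x, K t x)) := by
      refine tendsto_integral_of_dominated_convergence _ (fun j => ?_) hdomi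
        (fun j => Eventually.of_forall fun x => ?_) (Eventually.of_forall fun x => ?_)
      · exact (hgc _ t (hk₀ j)).aestronglyMeasurable
      · have hb := hgb _ t (hk₀ j) x
        have h0 : 0 ≤ g (j + k₀) t x := by
          refine le_trans ?_ hb.1
          have h1 : 0 < (0:ℝ) - t := by linarith
          exact (mul_pos (mul_pos hc₁ (Real.rpow_pos_of_pos h1 _)) (Real.exp_pos _)).le
        rw [Real.norm_eq_abs, abs_of_nonneg h0]
        exact hb.2
      · exact (hgK t ht' x).comp (tendsto_add_atTop_nat k₀)
    have hconst : Tendsto (fun j => ∫ x, g (j + k₀) t x) atTop (𝓝 1) := by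
      have e : (fun j => ∫ x, g (j + k₀) t x) = fun _ => 1 := funext fun j => hg1 _ t (hk₀ j)
      rw [e]
      exact tendsto_const_nhds
    exact tendsto_nhds_unique hlim hconst
  refine ⟨⟨hKc, hK0, hKeq, hK1, ?_⟩, hKb⟩
  exact tendsto_integral_mul_of_gaussian_upper_fin_three hC₂ (fun t ht x => (hK0 t ht x).le)
    (fun t ht x => (hKb t ht x).2) hK1

/-- **`TangentFlowTransfer` from (B) kernel stability and (C) non-degeneracy** (module
docstring). Hypothesis `hB`: unit viscosity, pole `(0, 0)`; data = classical Type-I Oseen-mild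
fields `w_k` on windows `[A_k, 0)`, `A_k → −∞`, with adapted kernels `g_k` under two-sided
Gaussian bounds with fixed constants, converging slice-wise locally uniformly with two derivatives
to a Type-I ancient mild `W`; conclusion = a subsequence of the kernels converges pointwise to a
jointly `C²` solution `K` of the limit adjoint equation `∂ₜK + W·∇K + ΔK = 0` on `(−∞, 0)` (the
remaining kernel clauses and the Gaussian bounds then follow, `isAdaptedBackwardKernel_of_limit`).
Hypothesis `hC`: for the data
of the item, every slice-wise locally uniform limit `W` (Type-I ancient mild) of the
viscosity-normalised zooms `λ_k u♭(νT + λ_k² ·, x₀ + λ_k ·)`, `λ_k → 0⁺`, about the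
backward-singular pole has `curl W(τ) ≢ 0` for every `τ < 0`. [folklore] -/
theorem tangentFlowTransfer_of_hyp
    (hB : ∀ (C₀ c₁ c₂ C₁ C₂ : ℝ) (A : ℕ → ℝ) (w : ℕ → ℝ → ℝ³ → ℝ³) (pw : ℕ → ℝ → ℝ³ → ℝ)
        (g : ℕ → ℝ → ℝ³ → ℝ) (W : ℝ → ℝ³ → ℝ³),
      0 ≤ C₀ → 0 < c₁ → 0 < c₂ → 0 < C₁ → 0 < C₂ → Tendsto A atTop atBot →
      (∀ k, IsClassicalNSSolutionOn (Ico (A k) 0) 1 0 (w k) (pw k)) →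
      (∀ k, ∀ t ∈ Ioo (A k) 0, ∀ x, ‖w k t x‖ ≤ C₀ / Real.sqrt (-t)) →
      (∀ k, ∀ s t : ℝ, A k < s → s < t → t < 0 → ∀ x,
        w k t x = UnboundedOperators.heatExtension (w k s) (t - s) x -
          oseenDuhamel 1 s (w k) (w k) t x) →
      (∀ k, IsAdaptedBackwardKernel 1 (w k) (Ico (A k) 0) 0 0 (g k)) →
      (∀ k, ∀ t ∈ Ico (A k) 0, ∀ x,
        c₁ * ((0:ℝ) - t) ^ (-(3:ℝ) / 2) * Real.exp (-(‖x - (0 : ℝ³)‖ ^ 2) / (c₂ * ((0:ℝ) - t))) ≤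
            g k t x ∧
          g k t x ≤ C₁ * ((0:ℝ) - t) ^ (-(3:ℝ) / 2) *
            Real.exp (-(‖x - (0 : ℝ³)‖ ^ 2) / (C₂ * ((0:ℝ) - t)))) →
      IsTypeIAncientMild C₀ W →
      (∀ t < 0, TendstoLocallyUniformly (fun k => w k t) (W t) atTop) →
      (∀ t < 0, TendstoLocallyUniformly (fun k => fderiv ℝ (w k t)) (fderiv ℝ (W t)) atTop) →
      (∀ t < 0, TendstoLocallyUniformly (fun k => fderiv ℝ (fderiv ℝ (w k t)))
        (fderiv ℝ (fderiv ℝ (W t))) atTop) →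
      ∃ ψ : ℕ → ℕ, StrictMono ψ ∧ ∃ K : ℝ → ℝ³ → ℝ,
        ContDiffOn ℝ 2 (uncurry K) (Iio 0 ×ˢ univ) ∧
        (∀ t ∈ Iio (0:ℝ), ∀ x,
          timeDerivWithin (Iio 0) K t x + fderiv ℝ (K t) x (W t x) + 1 * (Δ (K t)) x = 0) ∧
        (∀ t < 0, ∀ x, Tendsto (fun j => g (ψ j) t x) atTop (𝓝 (K t x))))
    (hC : ∀ (ν T : ℝ), 0 < ν → 0 < T → ∀ (u : ℝ → ℝ³ → ℝ³) (p : ℝ → ℝ³ → ℝ),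
      IsClassicalNSSolutionOn (Ico 0 T) ν 0 u p → IsLerayHopfOn T ν 0 (u 0) u →
      HasRapidSpatialDecay (u 0) → IsTypeIBlowup u T →
      ∀ (x₀ : ℝ³), (∀ r : ℝ, 0 < r → eLpNorm (uncurry u) ⊤
        (volume.restrict (parabolicCylinder r ((T, x₀) : ℝ × ℝ³))) = ⊤) →
      ∀ (c : ℕ → ℝ), (∀ k, 0 < c k) → Tendsto c atTop (𝓝 0) →
      ∀ (C₀ : ℝ) (W : ℝ → ℝ³ → ℝ³), IsTypeIAncientMild C₀ W →
      (∀ t < 0, TendstoLocallyUniformly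
        (fun k => (c k • stPull (c k ^ 2) (c k) (ν * T) x₀ (ν⁻¹ • stPull ν⁻¹ 1 0 0 u)) t)
        (W t) atTop) →
      ∀ τ < 0, ∃ x, curl (W τ) x ≠ 0) :
    Summit.NavierStokesRegularity.NavierStokesRegularity.Theses.AdaptedFrequency.TangentFlowTransfer := by
  intro ν T hν hT u p hcl hLH hdec hTI x₀ t₀ G ht₀ hsing hKcl hGb H Λ hH hΛ Λ₀ hlim
  subst hH hΛ
  -- the kernel clauses and the Gaussian comparability of the item
  have hK : IsAdaptedBackwardKernel ν u (Ico t₀ T) T x₀ G := isAdaptedBackwardKernel_iff.2 hKcl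
  obtain ⟨c₁, c₂, C₁, C₂, hc₁, hc₂, hC₁, hC₂, hGb'⟩ := hGb
  have hlim' : Tendsto (adaptedFrequency u G T) (𝓝[<] T) (𝓝 Λ₀) := hlim
  -- a Type-I window
  obtain ⟨C, t₁, ht₁T, hI⟩ := exists_window_of_isTypeIBlowup hTI
  -- S1–S3: the viscosity-normalised, zoomed blow-up sequence
  set c : ℕ → ℝ := fun k => 1 / ((k:ℝ) + 1) with hcdef
  have hc : ∀ k, 0 < c k := fun k => one_div_nat_succ_pos k
  have hc0 : Tendsto c atTop (𝓝 0) := tendsto_one_div_add_atTop_nhds_zero_nat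
  obtain ⟨C₀, A, w, pw, g, hwdef, hC₀, hA, -, hclw, hIw, hmildw, hgw, hgb, hfreq⟩ :=
    exists_zoom_blowupData hν hT hcl hLH ht₁T hI ht₀ hK hGb' hlim' hc hc0
  -- S4: `C²_loc` extraction
  have hcont : ∀ k, ContinuousOn (uncurry (w k)) (Ioo (A k) 0 ×ˢ univ) := fun k =>
    (hclw k).smooth_velocity.continuousOn.mono (prod_mono Ioo_subset_Ico_self Subset.rfl)
  have hwdf : ∀ k, ∀ t ∈ Ioo (A k) 0, IsWeaklyDivFree (w k t) := fun k t ht =>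
    VectorCalculus.IsDivFree.isWeaklyDivFree_holds ((hclw k).divFree t (Ioo_subset_Ico_self ht))
      (contDiff_infty.1 ((hclw k).contDiff_velocity (Ioo_subset_Ico_self ht)) 1)
  obtain ⟨φ, hφ, W, hW, hW0, hW1, hW2⟩ :=
    exists_tendsto_of_typeI_oseenMild_windows hC₀ hA hcont hwdf hmildw hIw
  -- S5: kernel stability along the subsequence
  have hφt : Tendsto φ atTop atTop := hφ.tendsto_atTop
  have hc₁' : 0 < c₁ * ν ^ ((3:ℝ) / 2) := mul_pos hc₁ (Real.rpow_pos_of_pos hν _)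
  have hC₁' : 0 < C₁ * ν ^ ((3:ℝ) / 2) := mul_pos hC₁ (Real.rpow_pos_of_pos hν _)
  have hc₂' : 0 < c₂ / ν := div_pos hc₂ hν
  have hC₂' : 0 < C₂ / ν := div_pos hC₂ hν
  obtain ⟨ψ, hψ, K, hKc, hKeq, hgK⟩ := hB C₀ (c₁ * ν ^ ((3:ℝ) / 2)) (c₂ / ν)
    (C₁ * ν ^ ((3:ℝ) / 2)) (C₂ / ν) (A ∘ φ) (fun k => w (φ k)) (fun k => pw (φ k))
    (fun k => g (φ k)) W hC₀ hc₁' hc₂' hC₁' hC₂' (hA.comp hφt) (fun k => hclw (φ k))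
    (fun k => hIw (φ k)) (fun k => hmildw (φ k)) (fun k => hgw (φ k)) (fun k => hgb (φ k))
    hW hW0 hW1 hW2
  have hψt : Tendsto ψ atTop atTop := hψ.tendsto_atTop
  have hφψt : Tendsto (fun j => φ (ψ j)) atTop atTop := hφt.comp hψt
  obtain ⟨hKW, hKb⟩ := isAdaptedBackwardKernel_of_limit (g := fun j => g (φ (ψ j)))
    (A := fun j => A (φ (ψ j))) (hA.comp hφψt) (fun j => (hgw _).integral_eq_one)
    (fun j t ht => ((hgw _).contDiff_slice ht).continuous) hc₁' hC₂'
    (fun j => hgb (φ (ψ j))) hKc hKeq hgK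
  -- S6: one pressure for the tangent flow
  obtain ⟨q, hWcl⟩ := exists_isClassicalNSSolutionOn_Iio_of_isTypeIAncientMild hW
  -- S8a: positivity of the limit adapted enstrophy via (C)
  have hne : ∀ τ < 0, ∃ x, curl (W τ) x ≠ 0 := by
    refine hC ν T hν hT u p hcl hLH hdec hTI x₀ hsing (fun j => c (φ (ψ j)))
      (fun j => hc _) (hc0.comp hφψt) C₀ W hW fun t ht => ?_
    have h := tendstoLocallyUniformly_comp_of_tendsto (hW0 t ht) hψt
    rw [hwdef] at h
    exact h
  have hposW : ∀ τ < 0, 0 < adaptedEnstrophy W K τ := by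
    intro τ hτ
    -- a gradient bound for `W τ` from the uniform window bounds
    obtain ⟨M, -, hM⟩ := exists_slab_bounds_of_typeI_windows hC₀ hτ
    have hτU : τ ∈ Ioo (2 * τ) (τ / 2) := ⟨by linarith, by linarith⟩
    have hev : ∀ᶠ j in atTop, A (φ (ψ j)) < 3 * τ :=
      hφψt.eventually (hA.eventually (eventually_lt_atBot _))
    have hDW : ∀ x, ‖fderiv ℝ (W τ) x‖ ≤ M := fun x =>
      le_of_tendsto ((tendsto_at_of_tendstoLocallyUniformly (hW1 τ hτ) x).comp hψt).norm
        (hev.mono fun j hj => (hM hj (hclw _) (hmildw _) (hIw _) τ hτU x).2.1)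
    have hcurl : ∀ x, ‖curl (W τ) x‖ ≤ ‖curlCLM‖ * M := fun x =>
      (norm_curl_le (W τ) x).trans (mul_le_mul_of_nonneg_left (hDW x) (norm_nonneg curlCLM))
    have hτ' : τ ∈ Iio (0:ℝ) := hτ
    exact adaptedEnstrophy_pos_of_exists_curl_ne_zero
      ((contDiff_infty.1 (hWcl.contDiff_velocity hτ') 1)) hcurl (hne τ hτ)
      (hKW.contDiff_slice hτ').continuous (hKW.pos τ hτ') (hKW.integrable hτ')
  -- S8b: transfer of the frequency along `k ↦ φ (ψ k)`
  have hΛW : ∀ τ < 0, adaptedFrequency W K 0 τ = Λ₀ :=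
    adaptedFrequency_limit_eq hC₀ (hA.comp hφψt) (fun k => hclw (φ (ψ k)))
      (fun k => hmildw (φ (ψ k))) (fun k => hIw (φ (ψ k))) (fun k => hgw (φ (ψ k))) hC₁'.le hC₂'
      (fun k t ht x => (hgb (φ (ψ k)) t ht x).2) hWcl hKW
      (fun t ht x => (tendsto_at_of_tendstoLocallyUniformly (hW1 t ht) x).comp hψt)
      (fun t ht x => (tendsto_at_of_tendstoLocallyUniformly (hW2 t ht) x).comp hψt) hgK
      (fun τ hτ => (hfreq τ hτ).comp hφψt) hposW
  -- S7: back to viscosity `ν`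
  have h3 : Module.finrank ℝ ℝ³ = 3 := finrank_euclideanSpace_fin
  have h3' : ((Module.finrank ℝ ℝ³ : ℕ) : ℝ) = 3 := by rw [h3]; norm_num
  have hvcl := isClassicalNSSolutionOn_dilate_Iio hWcl hν
  rw [mul_one] at hvcl
  have hKν := isAdaptedBackwardKernel_dilate_Iio hKW hν
  rw [mul_one] at hKν
  have hKνb := gaussian_bounds_dilate_Iio (E := ℝ³) (G := K) (x₀ := (0 : ℝ³))
    (c₁ := c₁ * ν ^ ((3:ℝ) / 2)) (c₂ := c₂ / ν) (C₁ := C₁ * ν ^ ((3:ℝ) / 2)) (C₂ := C₂ / ν) hν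
    (by rw [h3']; exact hKb)
  rw [h3'] at hKνb
  refine ⟨C₀ * Real.sqrt ν, ν • stPull ν 1 0 0 W, ν ^ 2 • stPull ν 1 0 0 q, stPull ν 1 0 0 K,
    hvcl, typeI_bound_dilate (fun t ht x => hW.norm_le ht x) hν, hKν.contDiffOn, hKν.pos,
    hKν.adjoint_eq, hKν.integral_eq_one, hKν.tendsto_integral_mul, ?_, ?_⟩
  · refine ⟨c₁ * ν ^ ((3:ℝ) / 2) * ν ^ (-(3:ℝ) / 2), c₂ / ν * ν,
      C₁ * ν ^ ((3:ℝ) / 2) * ν ^ (-(3:ℝ) / 2), C₂ / ν * ν,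
      mul_pos hc₁' (Real.rpow_pos_of_pos hν _), mul_pos hc₂' hν,
      mul_pos hC₁' (Real.rpow_pos_of_pos hν _), mul_pos hC₂' hν, hKνb⟩
  · rintro _ _ rfl rfl
    exact ⟨adaptedEnstrophy_dilate_pos hposW hν, adaptedFrequency_dilate_const hΛW hν⟩

/-- **`TangentFlowTransfer` from non-degeneracy of the tangent flow alone.** Kernel stability
being proved (`kernelStability`), the item follows from hypothesis (C): at a backward-singular
point of a Type-I Leray–Hopf classical solution, every slice-wise locally uniform limit `W`
(Type-I ancient mild) of the viscosity-normalised parabolic zooms has `curl W(τ) ≢ 0` for every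
`τ < 0` (persistence of the singularity + uniqueness of bounded mild solutions; not in the tree).
[folklore] -/
theorem tangentFlowTransfer_of_nondegeneracy
    (hC : ∀ (ν T : ℝ), 0 < ν → 0 < T → ∀ (u : ℝ → ℝ³ → ℝ³) (p : ℝ → ℝ³ → ℝ),
      IsClassicalNSSolutionOn (Ico 0 T) ν 0 u p → IsLerayHopfOn T ν 0 (u 0) u →
      HasRapidSpatialDecay (u 0) → IsTypeIBlowup u T →
      ∀ (x₀ : ℝ³), (∀ r : ℝ, 0 < r → eLpNorm (uncurry u) ⊤
        (volume.restrict (parabolicCylinder r ((T, x₀) : ℝ × ℝ³))) = ⊤) →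
      ∀ (c : ℕ → ℝ), (∀ k, 0 < c k) → Tendsto c atTop (𝓝 0) →
      ∀ (C₀ : ℝ) (W : ℝ → ℝ³ → ℝ³), IsTypeIAncientMild C₀ W →
      (∀ t < 0, TendstoLocallyUniformly
        (fun k => (c k • stPull (c k ^ 2) (c k) (ν * T) x₀ (ν⁻¹ • stPull ν⁻¹ 1 0 0 u)) t)
        (W t) atTop) →
      ∀ τ < 0, ∃ x, curl (W τ) x ≠ 0) :
    Summit.NavierStokesRegularity.NavierStokesRegularity.Theses.AdaptedFrequency.TangentFlowTransfer :=
  tangentFlowTransfer_of_hyp kernelStability hC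

/-- **`TangentFlowTransfer` from persistence of the singularity in the blow-up limit.** The
item holds as soon as every slice-wise locally uniform limit `W` (Type-I ancient mild) of the
viscosity-normalised parabolic zooms of the solution about its backward-singular point is itself
backward-singular at the origin (`IsBackwardSingularPoint W (0, 0)`; Albritton–Barker 2019,
Prop. 2.3, persistence of singularities, for this blow-up sequence — the only remaining
hypothesis): non-degeneracy then follows from forward uniqueness and the Liouville theorem for
bounded irrotational incompressible fields (`exists_curl_ne_zero_of_isBackwardSingularPoint`).
[folklore] -/
theorem tangentFlowTransfer_of_persistence
    (hP : ∀ (ν T : ℝ), 0 < ν → 0 < T → ∀ (u : ℝ → ℝ³ → ℝ³) (p : ℝ → ℝ³ → ℝ),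
      IsClassicalNSSolutionOn (Ico 0 T) ν 0 u p → IsLerayHopfOn T ν 0 (u 0) u →
      HasRapidSpatialDecay (u 0) → IsTypeIBlowup u T →
      ∀ (x₀ : ℝ³), (∀ r : ℝ, 0 < r → eLpNorm (uncurry u) ⊤
        (volume.restrict (parabolicCylinder r ((T, x₀) : ℝ × ℝ³))) = ⊤) →
      ∀ (c : ℕ → ℝ), (∀ k, 0 < c k) → Tendsto c atTop (𝓝 0) →
      ∀ (C₀ : ℝ) (W : ℝ → ℝ³ → ℝ³), IsTypeIAncientMild C₀ W →
      (∀ t < 0, TendstoLocallyUniformly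
        (fun k => (c k • stPull (c k ^ 2) (c k) (ν * T) x₀ (ν⁻¹ • stPull ν⁻¹ 1 0 0 u)) t)
        (W t) atTop) →
      IsBackwardSingularPoint W ((0 : ℝ), (0 : ℝ³))) :
    Summit.NavierStokesRegularity.NavierStokesRegularity.Theses.AdaptedFrequency.TangentFlowTransfer :=
  tangentFlowTransfer_of_nondegeneracy fun ν T hν hT u p hcl hLH hdec hTI x₀ hsing c hc hc0 C₀ W hW hconv =>
    exists_curl_ne_zero_of_isBackwardSingularPoint hW
      (hP ν T hν hT u p hcl hLH hdec hTI x₀ hsing c hc hc0 C₀ W hW hconv)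

end Summit.NavierStokesRegularity.NavierStokesRegularity.Theorems

end
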